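import Mathlib
import Literature.Combinatorics.Enumerative.DoubleRestrictionsPowersOfTwo
import HarnessLib

/-!
# Simion–Schmidt (1985) §4 «Triple restrictions»: Lemma 6, Proposition 15 (Fibonacci), Proposition 16

Permutations of length `n` avoiding THREE patterns of length three, on the tree's notion
`Literature.Combinatorics.Enumerative.PermContainsPattern`;
`A_n(τ₁, τ₂, τ₃) = Nat.card {v : Perm (Fin n) // ¬ C v τ₁ ∧ ¬ C v τ₂ ∧ ¬ C v τ₃}`.

* §0 symmetry of triples under reversal / complementation; LEMMA 6 «(a) `A_n(123,132,213) = A_n(231,312,321)`;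
  (b) `A_n(123,132,231) = A_n(123,213,312) = A_n(132,231,321) = A_n(213,312,321)`; (c) `A_n(132,213,231) =
  A_n(132,213,312) = A_n(132,231,312) = A_n(213,231,312)`; (d) `A_n(123,132,312) = A_n(123,213,231) =
  A_n(132,312,321) = A_n(213,231,321)`; (e) `A_n(123,231,312) = A_n(132,213,321)`; (f) `A_n(R) = 0` for all
  `R ⊇ {123, 321}` if `n ≥ 5`».
* §1 ★ PROPOSITION 15 «`A_n(123, 132, 213) = F_{n+1}`», `F` the Fibonacci numbers (`Nat.fib`): as printed,
  `σ⁻¹(n) ≤ 2` (else `123` or `213`), `σ(1) = n` leaves an avoider of length `n − 1`, `σ(2) = n` forces `σ(1) = n − 1`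
  (else `132`) and leaves an avoider of length `n − 2`; `A_n = A_{n−1} + A_{n−2}`.
* §2 PROPOSITION 16 «`A_n(123, 132, 231) = n`» (`n ≥ 1`): `σ(1) = n` or `σ = (n−1, …, 1, n)`; `A_n = 1 + A_{n−1}`;
  with Lemma 6 (b) the same for `(123,213,312)`, `(132,231,321)`, `(213,312,321)`.
All counts are first proved on words (arrangements of a finset of a linear order, patterns as sublists) with the
split/glue tools of `DoubleRestrictionsPowersOfTwo`, then transferred.

## References
* [SimionSchmidt1985] R. Simion, F. W. Schmidt, Restricted permutations, European J. Combin. 6 (1985) 383–406, §4: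
  Lemma 6, Propositions 15, 16 (held text `paper:doi-10-1016-s0195-6698-85-80052-4`, p0013–p0015).
* [Bona2012] M. Bóna, Combinatorics of Permutations, 2nd ed., CRC Press 2012, §4.2 (held text p0129).
-/

namespace Literature.Combinatorics.Enumerative

namespace PermContainsPattern

open Finset Equiv

/-! ### §0 Symmetries of triples; LEMMA 6 -/

section Lemma6

variable {n m₁ m₂ m₃ : ℕ}

/-- Reversal acts on triples of restrictions: `A_n(p, q, r) = A_n(p^r, q^r, r^r)`.
[cite: SimionSchmidt1985, Lemma 6 (proof) and Lemma 1 (held text p0014, p0002)] -/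
theorem card_av_triple_reverse (n : ℕ) (p : Fin m₁ → ℕ) (q : Fin m₂ → ℕ) (r : Fin m₃ → ℕ) :
    Nat.card {v : Perm (Fin n) // ¬ PermContainsPattern v p ∧ ¬ PermContainsPattern v q ∧ ¬ PermContainsPattern v r} =
      Nat.card {v : Perm (Fin n) // ¬ PermContainsPattern v (p ∘ Fin.rev) ∧ ¬ PermContainsPattern v (q ∘ Fin.rev) ∧
        ¬ PermContainsPattern v (r ∘ Fin.rev)} := by
  have hp : (p ∘ Fin.rev) ∘ Fin.rev = p := funext fun a => by simp
  have hq : (q ∘ Fin.rev) ∘ Fin.rev = q := funext fun a => by simp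
  have hr : (r ∘ Fin.rev) ∘ Fin.rev = r := funext fun a => by simp
  exact Nat.card_congr <| Equiv.subtypeEquiv (Equiv.mulRight Fin.revPerm) fun v => by
    rw [Equiv.coe_mulRight, reverse_iff, reverse_iff, reverse_iff, hp, hq, hr]

/-- Complementation acts on triples of restrictions: `A_n(p, q, r) = A_n(p^c, q^c, r^c)`.
[cite: SimionSchmidt1985, Lemma 6 (proof) and Lemma 1 (held text p0014, p0002)] -/
theorem card_av_triple_complement (n : ℕ) {p : Fin m₁ → ℕ} {q : Fin m₂ → ℕ} {r : Fin m₃ → ℕ} {M₁ M₂ M₃ : ℕ}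
    (h₁ : ∀ a, p a ≤ M₁) (h₂ : ∀ a, q a ≤ M₂) (h₃ : ∀ a, r a ≤ M₃) :
    Nat.card {v : Perm (Fin n) // ¬ PermContainsPattern v p ∧ ¬ PermContainsPattern v q ∧ ¬ PermContainsPattern v r} =
      Nat.card {v : Perm (Fin n) // ¬ PermContainsPattern v (fun a => M₁ - p a) ∧
        ¬ PermContainsPattern v (fun a => M₂ - q a) ∧ ¬ PermContainsPattern v (fun a => M₃ - r a)} := by
  have g₁ : ∀ a, M₁ - p a ≤ M₁ := fun a => Nat.sub_le M₁ (p a)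
  have g₂ : ∀ a, M₂ - q a ≤ M₂ := fun a => Nat.sub_le M₂ (q a)
  have g₃ : ∀ a, M₃ - r a ≤ M₃ := fun a => Nat.sub_le M₃ (r a)
  have e₁ : ∀ a b : Fin m₁, (M₁ - (M₁ - p a) < M₁ - (M₁ - p b) ↔ p a < p b) := fun a b => by
    have := h₁ a; have := h₁ b; constructor <;> intro <;> omega
  have e₂ : ∀ a b : Fin m₂, (M₂ - (M₂ - q a) < M₂ - (M₂ - q b) ↔ q a < q b) := fun a b => by
    have := h₂ a; have := h₂ b; constructor <;> intro <;> omega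
  have e₃ : ∀ a b : Fin m₃, (M₃ - (M₃ - r a) < M₃ - (M₃ - r b) ↔ r a < r b) := fun a b => by
    have := h₃ a; have := h₃ b; constructor <;> intro <;> omega
  refine Nat.card_congr <| Equiv.subtypeEquiv (Equiv.mulLeft Fin.revPerm) fun v => ?_
  rw [Equiv.coe_mulLeft, complement_iff _ g₁, complement_iff _ g₂, complement_iff _ g₃, congr_pattern e₁ v,
    congr_pattern e₂ v, congr_pattern e₃ v]

/-- Reordering the three restrictions, rotation: `A_n(p, q, r) = A_n(q, r, p)`. [cite: SimionSchmidt1985, §4 (held text p0013)] -/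
theorem card_av_triple_rotate (n : ℕ) (p : Fin m₁ → ℕ) (q : Fin m₂ → ℕ) (r : Fin m₃ → ℕ) :
    Nat.card {v : Perm (Fin n) // ¬ PermContainsPattern v p ∧ ¬ PermContainsPattern v q ∧ ¬ PermContainsPattern v r} =
      Nat.card {v : Perm (Fin n) // ¬ PermContainsPattern v q ∧ ¬ PermContainsPattern v r ∧ ¬ PermContainsPattern v p} :=
  Nat.card_congr <| Equiv.subtypeEquivRight fun _ => ⟨fun ⟨a, b, c⟩ => ⟨b, c, a⟩, fun ⟨b, c, a⟩ => ⟨a, b, c⟩⟩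

/-- Reordering the three restrictions, transposition: `A_n(p, q, r) = A_n(q, p, r)`. [cite: SimionSchmidt1985, §4 (held text p0013)] -/
theorem card_av_triple_swap (n : ℕ) (p : Fin m₁ → ℕ) (q : Fin m₂ → ℕ) (r : Fin m₃ → ℕ) :
    Nat.card {v : Perm (Fin n) // ¬ PermContainsPattern v p ∧ ¬ PermContainsPattern v q ∧ ¬ PermContainsPattern v r} =
      Nat.card {v : Perm (Fin n) // ¬ PermContainsPattern v q ∧ ¬ PermContainsPattern v p ∧ ¬ PermContainsPattern v r} :=
  Nat.card_congr <| Equiv.subtypeEquivRight fun _ => ⟨fun ⟨a, b, c⟩ => ⟨b, a, c⟩, fun ⟨b, a, c⟩ => ⟨a, b, c⟩⟩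

/-- Word identities: `213^c = 231`. [cite: SimionSchmidt1985, Lemma 1 (held text p0002)] -/
theorem compl_213 : (fun a => 4 - (![2, 1, 3] : Fin 3 → ℕ) a) = ![2, 3, 1] := funext fun a => by fin_cases a <;> rfl
/-- `312^c = 132`. [cite: SimionSchmidt1985, Lemma 1 (held text p0002)] -/
theorem compl_312 : (fun a => 4 - (![3, 1, 2] : Fin 3 → ℕ) a) = ![1, 3, 2] := funext fun a => by fin_cases a <;> rfl

/-- The letters of `123` are at most `4`. [folklore] -/
private theorem bd_123 : ∀ a, (![1, 2, 3] : Fin 3 → ℕ) a ≤ 4 := fun a => by fin_cases a <;> decide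
/-- The letters of `132` are at most `4`. [folklore] -/
private theorem bd_132 : ∀ a, (![1, 3, 2] : Fin 3 → ℕ) a ≤ 4 := fun a => by fin_cases a <;> decide
/-- The letters of `213` are at most `4`. [folklore] -/
private theorem bd_213 : ∀ a, (![2, 1, 3] : Fin 3 → ℕ) a ≤ 4 := fun a => by fin_cases a <;> decide
/-- The letters of `231` are at most `4`. [folklore] -/
private theorem bd_231 : ∀ a, (![2, 3, 1] : Fin 3 → ℕ) a ≤ 4 := fun a => by fin_cases a <;> decide
/-- The letters of `312` are at most `4`. [folklore] -/
private theorem bd_312 : ∀ a, (![3, 1, 2] : Fin 3 → ℕ) a ≤ 4 := fun a => by fin_cases a <;> decide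
/-- The letters of `321` are at most `4`. [folklore] -/
private theorem bd_321 : ∀ a, (![3, 2, 1] : Fin 3 → ℕ) a ≤ 4 := fun a => by fin_cases a <;> decide

/-- LEMMA 6 (a) «`A_n(123, 132, 213) = A_n(231, 312, 321)`» (reverse). [cite: SimionSchmidt1985, Lemma 6 (a) (held text p0013)] -/
theorem card_av123_av132_av213_eq_card_av231_av312_av321 (n : ℕ) :
    Nat.card {v : Perm (Fin n) // ¬ PermContainsPattern v ![1, 2, 3] ∧ ¬ PermContainsPattern v ![1, 3, 2] ∧
      ¬ PermContainsPattern v ![2, 1, 3]} =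
    Nat.card {v : Perm (Fin n) // ¬ PermContainsPattern v ![2, 3, 1] ∧ ¬ PermContainsPattern v ![3, 1, 2] ∧
      ¬ PermContainsPattern v ![3, 2, 1]} := by
  rw [card_av_triple_reverse, rev_123, rev_132, rev_213, card_av_triple_rotate]

/-- LEMMA 6 (b), first equality «`A_n(123, 132, 231) = A_n(123, 213, 312)`» (reverse–complement).
[cite: SimionSchmidt1985, Lemma 6 (b) (held text p0013)] -/
theorem card_av123_av132_av231_eq_card_av123_av213_av312 (n : ℕ) :
    Nat.card {v : Perm (Fin n) // ¬ PermContainsPattern v ![1, 2, 3] ∧ ¬ PermContainsPattern v ![1, 3, 2] ∧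
      ¬ PermContainsPattern v ![2, 3, 1]} =
    Nat.card {v : Perm (Fin n) // ¬ PermContainsPattern v ![1, 2, 3] ∧ ¬ PermContainsPattern v ![2, 1, 3] ∧
      ¬ PermContainsPattern v ![3, 1, 2]} := by
  rw [card_av_triple_reverse, rev_123, rev_132, rev_231, card_av_triple_complement n bd_321 bd_231 bd_132,
    compl_321, compl_231, compl_132]

/-- LEMMA 6 (b), second equality «`A_n(123, 132, 231) = A_n(132, 231, 321)`» (reverse).
[cite: SimionSchmidt1985, Lemma 6 (b) (held text p0013)] -/
theorem card_av123_av132_av231_eq_card_av132_av231_av321 (n : ℕ) :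
    Nat.card {v : Perm (Fin n) // ¬ PermContainsPattern v ![1, 2, 3] ∧ ¬ PermContainsPattern v ![1, 3, 2] ∧
      ¬ PermContainsPattern v ![2, 3, 1]} =
    Nat.card {v : Perm (Fin n) // ¬ PermContainsPattern v ![1, 3, 2] ∧ ¬ PermContainsPattern v ![2, 3, 1] ∧
      ¬ PermContainsPattern v ![3, 2, 1]} := by
  rw [card_av_triple_reverse, rev_123, rev_132, rev_231, card_av_triple_rotate, card_av_triple_swap]

/-- LEMMA 6 (b), third equality «`A_n(123, 132, 231) = A_n(213, 312, 321)`» (complement).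
[cite: SimionSchmidt1985, Lemma 6 (b) (held text p0013)] -/
theorem card_av123_av132_av231_eq_card_av213_av312_av321 (n : ℕ) :
    Nat.card {v : Perm (Fin n) // ¬ PermContainsPattern v ![1, 2, 3] ∧ ¬ PermContainsPattern v ![1, 3, 2] ∧
      ¬ PermContainsPattern v ![2, 3, 1]} =
    Nat.card {v : Perm (Fin n) // ¬ PermContainsPattern v ![2, 1, 3] ∧ ¬ PermContainsPattern v ![3, 1, 2] ∧
      ¬ PermContainsPattern v ![3, 2, 1]} := by
  rw [card_av_triple_complement n bd_123 bd_132 bd_231, compl_123, compl_132, compl_231, card_av_triple_rotate,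
    card_av_triple_swap]

/-- LEMMA 6 (c), first equality «`A_n(132, 213, 231) = A_n(132, 213, 312)`» (reverse–complement).
[cite: SimionSchmidt1985, Lemma 6 (c) (held text p0014)] -/
theorem card_av132_av213_av231_eq_card_av132_av213_av312 (n : ℕ) :
    Nat.card {v : Perm (Fin n) // ¬ PermContainsPattern v ![1, 3, 2] ∧ ¬ PermContainsPattern v ![2, 1, 3] ∧
      ¬ PermContainsPattern v ![2, 3, 1]} =
    Nat.card {v : Perm (Fin n) // ¬ PermContainsPattern v ![1, 3, 2] ∧ ¬ PermContainsPattern v ![2, 1, 3] ∧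
      ¬ PermContainsPattern v ![3, 1, 2]} := by
  rw [card_av_triple_reverse, rev_132, rev_213, rev_231, card_av_triple_complement n bd_231 bd_312 bd_132,
    compl_231, compl_312, compl_132, card_av_triple_swap]

/-- LEMMA 6 (c), second equality «`A_n(132, 213, 231) = A_n(132, 231, 312)`» (reverse).
[cite: SimionSchmidt1985, Lemma 6 (c) (held text p0014)] -/
theorem card_av132_av213_av231_eq_card_av132_av231_av312 (n : ℕ) :
    Nat.card {v : Perm (Fin n) // ¬ PermContainsPattern v ![1, 3, 2] ∧ ¬ PermContainsPattern v ![2, 1, 3] ∧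
      ¬ PermContainsPattern v ![2, 3, 1]} =
    Nat.card {v : Perm (Fin n) // ¬ PermContainsPattern v ![1, 3, 2] ∧ ¬ PermContainsPattern v ![2, 3, 1] ∧
      ¬ PermContainsPattern v ![3, 1, 2]} := by
  rw [card_av_triple_reverse, rev_132, rev_213, rev_231, card_av_triple_rotate, card_av_triple_rotate]

/-- LEMMA 6 (c), third equality «`A_n(132, 213, 231) = A_n(213, 231, 312)`» (complement).
[cite: SimionSchmidt1985, Lemma 6 (c) (held text p0014)] -/
theorem card_av132_av213_av231_eq_card_av213_av231_av312 (n : ℕ) :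
    Nat.card {v : Perm (Fin n) // ¬ PermContainsPattern v ![1, 3, 2] ∧ ¬ PermContainsPattern v ![2, 1, 3] ∧
      ¬ PermContainsPattern v ![2, 3, 1]} =
    Nat.card {v : Perm (Fin n) // ¬ PermContainsPattern v ![2, 1, 3] ∧ ¬ PermContainsPattern v ![2, 3, 1] ∧
      ¬ PermContainsPattern v ![3, 1, 2]} := by
  rw [card_av_triple_complement n bd_132 bd_213 bd_231, compl_132, compl_213, compl_231, card_av_triple_rotate,
    card_av_triple_swap]

/-- LEMMA 6 (d), first equality «`A_n(123, 132, 312) = A_n(123, 213, 231)`» (reverse–complement).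
[cite: SimionSchmidt1985, Lemma 6 (d) (held text p0014)] -/
theorem card_av123_av132_av312_eq_card_av123_av213_av231 (n : ℕ) :
    Nat.card {v : Perm (Fin n) // ¬ PermContainsPattern v ![1, 2, 3] ∧ ¬ PermContainsPattern v ![1, 3, 2] ∧
      ¬ PermContainsPattern v ![3, 1, 2]} =
    Nat.card {v : Perm (Fin n) // ¬ PermContainsPattern v ![1, 2, 3] ∧ ¬ PermContainsPattern v ![2, 1, 3] ∧
      ¬ PermContainsPattern v ![2, 3, 1]} := by
  rw [card_av_triple_reverse, rev_123, rev_132, rev_312,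
    card_av_triple_complement n bd_321 bd_231 bd_213,
    compl_321, compl_231, compl_213]

/-- LEMMA 6 (d), second equality «`A_n(123, 132, 312) = A_n(132, 312, 321)`» (complement).
[cite: SimionSchmidt1985, Lemma 6 (d) (held text p0014)] -/
theorem card_av123_av132_av312_eq_card_av132_av312_av321 (n : ℕ) :
    Nat.card {v : Perm (Fin n) // ¬ PermContainsPattern v ![1, 2, 3] ∧ ¬ PermContainsPattern v ![1, 3, 2] ∧
      ¬ PermContainsPattern v ![3, 1, 2]} =
    Nat.card {v : Perm (Fin n) // ¬ PermContainsPattern v ![1, 3, 2] ∧ ¬ PermContainsPattern v ![3, 1, 2] ∧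
      ¬ PermContainsPattern v ![3, 2, 1]} := by
  rw [card_av_triple_complement n bd_123 bd_132 bd_312, compl_123, compl_132, compl_312, card_av_triple_rotate,
    card_av_triple_swap]

/-- LEMMA 6 (d), third equality «`A_n(123, 132, 312) = A_n(213, 231, 321)`» (reverse).
[cite: SimionSchmidt1985, Lemma 6 (d) (held text p0014)] -/
theorem card_av123_av132_av312_eq_card_av213_av231_av321 (n : ℕ) :
    Nat.card {v : Perm (Fin n) // ¬ PermContainsPattern v ![1, 2, 3] ∧ ¬ PermContainsPattern v ![1, 3, 2] ∧
      ¬ PermContainsPattern v ![3, 1, 2]} =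
    Nat.card {v : Perm (Fin n) // ¬ PermContainsPattern v ![2, 1, 3] ∧ ¬ PermContainsPattern v ![2, 3, 1] ∧
      ¬ PermContainsPattern v ![3, 2, 1]} := by
  rw [card_av_triple_reverse, rev_123, rev_132, rev_312, card_av_triple_rotate, card_av_triple_swap]

/-- LEMMA 6 (e) «`A_n(123, 231, 312) = A_n(132, 213, 321)`» (reverse). [cite: SimionSchmidt1985, Lemma 6 (e) (held text p0014)] -/
theorem card_av123_av231_av312_eq_card_av132_av213_av321 (n : ℕ) :
    Nat.card {v : Perm (Fin n) // ¬ PermContainsPattern v ![1, 2, 3] ∧ ¬ PermContainsPattern v ![2, 3, 1] ∧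
      ¬ PermContainsPattern v ![3, 1, 2]} =
    Nat.card {v : Perm (Fin n) // ¬ PermContainsPattern v ![1, 3, 2] ∧ ¬ PermContainsPattern v ![2, 1, 3] ∧
      ¬ PermContainsPattern v ![3, 2, 1]} := by
  rw [card_av_triple_reverse, rev_123, rev_231, rev_312, card_av_triple_rotate]

/-- LEMMA 6 (f) «`A_n(R) = 0` for all `R ⊇ {123, 321}` if `n ≥ 5`» (any third restriction `r`).
[cite: SimionSchmidt1985, Lemma 6 (f) (held text p0014)] -/
theorem card_av123_av321_av_eq_zero {k : ℕ} (r : Fin k → ℕ) (n : ℕ) (hn : 5 ≤ n) :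
    Nat.card {v : Perm (Fin n) // ¬ PermContainsPattern v ![1, 2, 3] ∧ ¬ PermContainsPattern v ![3, 2, 1] ∧
      ¬ PermContainsPattern v r} = 0 := by
  rw [Nat.card_eq_zero]
  refine Or.inl ⟨fun ⟨v, h1, h2, _⟩ => ?_⟩
  rcases contains_123_or_321_of_five_le hn v with h | h
  · exact h1 h
  · exact h2 h

end Lemma6

/-! ### §1 PROPOSITION 15 — `A_n(123, 132, 213) = F_{n+1}` -/

section Prop15

variable {α : Type*} [LinearOrder α]

/-- ★★ **Proposition 15 on words.** The arrangements of a finite set `S` of letters with no `123`-, no `132`- and no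
`213`-sublist number `F_{#S + 1}` (Fibonacci): in an avoider `l₁ m l₂` split at the largest letter `m`, `l₁` has at most
one letter (an ascent `a b` before `m` gives `a b m = 123`, a descent gives `213`); if `l₁` is empty, `l₂` is any avoider
on the other letters; if `l₁ = x`, then `x` is the second largest letter (no `132`) and `l₂` any avoider on the rest.
Hence `A_n = A_{n−1} + A_{n−2}`. [cite: SimionSchmidt1985, Proposition 15 (held text p0014)] -/
theorem card_arrangements_not123_not132_not213
    [DecidablePred fun l : List α => (¬ ∃ a b c : α, [a, b, c].Sublist l ∧ a < b ∧ b < c) ∧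
      (¬ ∃ a b c : α, [a, b, c].Sublist l ∧ a < c ∧ c < b) ∧ ¬ ∃ a b c : α, [a, b, c].Sublist l ∧ b < a ∧ a < c]
    (S : Finset α) :
    ((Multiset.lists S.val).toFinset.filter (fun l => (¬ ∃ a b c : α, [a, b, c].Sublist l ∧ a < b ∧ b < c) ∧
      (¬ ∃ a b c : α, [a, b, c].Sublist l ∧ a < c ∧ c < b) ∧
        ¬ ∃ a b c : α, [a, b, c].Sublist l ∧ b < a ∧ a < c)).card = Nat.fib (S.card + 1) := by
  set av : Finset α → Finset (List α) := fun T => (Multiset.lists T.val).toFinset.filter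
    (fun l => (¬ ∃ a b c : α, [a, b, c].Sublist l ∧ a < b ∧ b < c) ∧
      (¬ ∃ a b c : α, [a, b, c].Sublist l ∧ a < c ∧ c < b) ∧
        ¬ ∃ a b c : α, [a, b, c].Sublist l ∧ b < a ∧ a < c) with hav
  have hmem_av : ∀ (T : Finset α) (l : List α), l ∈ av T ↔ (l.Nodup ∧ ∀ x, x ∈ l ↔ x ∈ T) ∧
      (¬ ∃ a b c : α, [a, b, c].Sublist l ∧ a < b ∧ b < c) ∧ (¬ ∃ a b c : α, [a, b, c].Sublist l ∧ a < c ∧ c < b) ∧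
        ¬ ∃ a b c : α, [a, b, c].Sublist l ∧ b < a ∧ a < c :=
    fun T l => by simp only [hav, Finset.mem_filter, mem_lists_toFinset_iff]
  have hav_empty : av ∅ = {[]} := by
    simp only [hav, lists_toFinset_empty]
    rw [Finset.filter_singleton, if_pos ⟨by rintro ⟨a, b, c, h, -⟩; simp at h, by rintro ⟨a, b, c, h, -⟩; simp at h,
      by rintro ⟨a, b, c, h, -⟩; simp at h⟩]
  change (av S).card = Nat.fib (S.card + 1)
  induction' hn : S.card using Nat.strong_induction_on with n ih generalizing S
  rcases n with _ | n
  · rw [Finset.card_eq_zero.mp hn, hav_empty, Finset.card_singleton]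
    rfl
  have hS : S.Nonempty := Finset.card_pos.mp (by omega)
  set m := S.max' hS with hm
  set S' := S.erase m with hS'def
  have hmS : m ∈ S := Finset.max'_mem S hS
  have hS' : S'.card = n := by rw [hS'def, Finset.card_erase_of_mem hmS, hn]; rfl
  have hltm : ∀ x ∈ S', x < m := fun x hx => Finset.lt_max'_of_mem_erase_max' S hS hx
  have hmS' : m ∉ S' := fun h => lt_irrefl m (hltm m h)
  have hmemS : ∀ x, x ∈ S ↔ x = m ∨ x ∈ S' := fun x => by
    rw [hS'def, Finset.mem_erase]
    constructor
    · intro hx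
      by_cases h : x = m
      · exact Or.inl h
      · exact Or.inr ⟨h, hx⟩
    · rintro (rfl | ⟨-, hx⟩)
      · exact hmS
      · exact hx
  -- «σ(1) = n»: `m` in front of an avoider on `S'`
  have hcons : ∀ l' ∈ av S', m :: l' ∈ av S := fun l' hl' => by
    rw [hmem_av] at hl' ⊢
    obtain ⟨⟨hnd, hmem⟩, h123, h132, h213⟩ := hl'
    have hlt : ∀ y ∈ l', y < m := fun y hy => hltm y ((hmem y).mp hy)
    have e123 := has123_append_max_iff [] l' m (by simp) hlt
    have e132 := has132_append_max_iff [] l' m (by simp) hlt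
    have e213 := has213_append_max_iff [] l' m (by simp) hlt
    rw [List.nil_append] at e123 e132 e213
    refine ⟨⟨List.nodup_cons.mpr ⟨fun h => hmS' ((hmem m).mp h), hnd⟩, fun x => ?_⟩, ?_, ?_, ?_⟩
    · rw [List.mem_cons, hmemS, hmem]
    · rw [e123]
      rintro (h | ⟨a, b, h, -⟩ | ⟨x, hx, -⟩)
      · exact h123 h
      · simp at h
      · simp at hx
    · rw [e132]
      rintro (⟨a, b, c, h, -⟩ | h | ⟨x, hx, -⟩)
      · simp at h
      · exact h132 h
      · simp at hx
    · rw [e213]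
      rintro (h | ⟨a, b, h, -⟩ | ⟨x, hx, -⟩)
      · exact h213 h
      · simp at h
      · simp at hx
  -- «σ(2) = n forces σ(1) = n − 1»: `x₀ m l''`, `x₀` the largest letter of `S'`, `l''` an avoider on `S' \ {x₀}`
  have hcons₂ : ∀ (hS'ne : S'.Nonempty), ∀ l'' ∈ av (S'.erase (S'.max' hS'ne)),
      S'.max' hS'ne :: m :: l'' ∈ av S := fun hS'ne l'' hl'' => by
    set x₀ := S'.max' hS'ne with hx₀
    rw [hmem_av] at hl'' ⊢
    obtain ⟨⟨hnd, hmem⟩, h123, h132, h213⟩ := hl''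
    have hx₀S' : x₀ ∈ S' := Finset.max'_mem _ _
    have hx₀m : x₀ < m := hltm x₀ hx₀S'
    have hlt'' : ∀ y ∈ l'', y < x₀ := fun y hy => Finset.lt_max'_of_mem_erase_max' S' hS'ne ((hmem y).mp hy)
    have hltm'' : ∀ y ∈ l'', y < m := fun y hy => (hlt'' y hy).trans hx₀m
    have hm₁ : ∀ x ∈ [x₀], x < m := fun x hx => by
      rw [List.mem_singleton] at hx
      rw [hx]
      exact hx₀m
    have e123 := has123_append_max_iff [x₀] l'' m hm₁ hltm''
    have e132 := has132_append_max_iff [x₀] l'' m hm₁ hltm''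
    have e213 := has213_append_max_iff [x₀] l'' m hm₁ hltm''
    rw [List.singleton_append] at e123 e132 e213
    refine ⟨⟨?_, fun x => ?_⟩, ?_, ?_, ?_⟩
    · refine List.nodup_cons.mpr ⟨fun h => ?_, List.nodup_cons.mpr
        ⟨fun h => hmS' (Finset.mem_of_mem_erase ((hmem m).mp h)), hnd⟩⟩
      rcases List.mem_cons.mp h with h | h
      · exact hx₀m.ne h
      · exact lt_irrefl x₀ (hlt'' x₀ h)
    · rw [List.mem_cons, List.mem_cons, hmem, Finset.mem_erase, hmemS]
      constructor
      · rintro (rfl | rfl | ⟨-, hx⟩)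
        · exact Or.inr hx₀S'
        · exact Or.inl rfl
        · exact Or.inr hx
      · rintro (rfl | hx)
        · exact Or.inr (Or.inl rfl)
        · by_cases h : x = x₀
          · exact Or.inl h
          · exact Or.inr (Or.inr ⟨h, hx⟩)
    · rw [e123]
      rintro (h | ⟨a, b, hs, -⟩ | ⟨x, hx, b, c, hs, hxb, -⟩)
      · exact h123 h
      · have := hs.length_le
        simp at this
      · rw [List.mem_singleton] at hx
        rw [hx] at hxb
        exact absurd hxb (not_lt.mpr (hlt'' b (hs.subset (by simp))).le)
    · rw [e132]
      rintro (⟨a, b, c, hs, -⟩ | h | ⟨x, hx, y, hy, hxy⟩)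
      · have := hs.length_le
        simp at this
      · exact h132 h
      · rw [List.mem_singleton] at hx
        rw [hx] at hxy
        exact absurd hxy (not_lt.mpr (hlt'' y hy).le)
    · rw [e213]
      rintro (h | ⟨a, b, hs, -⟩ | ⟨x, hx, b, c, hs, -, hxc⟩)
      · exact h213 h
      · have := hs.length_le
        simp at this
      · rw [List.mem_singleton] at hx
        rw [hx] at hxc
        exact absurd hxc (not_lt.mpr (hlt'' c (hs.subset (by simp))).le)
  -- «σ⁻¹(n) ≤ 2, else either 123 or 213 could not be avoided»: every avoider is of one of the two forms
  have hsplit : ∀ l ∈ av S, (∃ l' ∈ av S', m :: l' = l) ∨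
      ∃ hS'ne : S'.Nonempty, ∃ l'' ∈ av (S'.erase (S'.max' hS'ne)), S'.max' hS'ne :: m :: l'' = l := fun l hl => by
    rw [hmem_av] at hl
    obtain ⟨⟨hnd, hmem⟩, h123, h132, h213⟩ := hl
    obtain ⟨l₁, l₂, rfl, hn₁, hn₂, -, hmem₂, hmem₁, hm₁, hm₂, hbelow⟩ :=
      exists_split_at_max S' hltm hnd (fun x => by rw [hmem x, hmemS]) h132
    have hsub : l₂.Sublist (l₁ ++ m :: l₂) := (List.sublist_cons_self m l₂).trans (List.sublist_append_right _ _)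
    have hS'₂ : ∀ y ∈ l₂, y ∈ S' := fun y hy => Finset.filter_subset _ _ ((hmem₂ y).mp hy)
    rcases l₁ with _ | ⟨x, _ | ⟨y, t⟩⟩
    · -- `l₁ = []`
      left
      refine ⟨l₂, ?_, rfl⟩
      rw [hmem_av]
      refine ⟨⟨hn₂, fun y => ⟨hS'₂ y, fun hy => ?_⟩⟩, fun ⟨a, b, c, hs, hh⟩ => h123 ⟨a, b, c, hs.trans hsub, hh⟩,
        fun ⟨a, b, c, hs, hh⟩ => h132 ⟨a, b, c, hs.trans hsub, hh⟩,
        fun ⟨a, b, c, hs, hh⟩ => h213 ⟨a, b, c, hs.trans hsub, hh⟩⟩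
      have := (hmem y).mpr ((hmemS y).mpr (Or.inr hy))
      rw [List.nil_append, List.mem_cons] at this
      rcases this with rfl | h
      · exact absurd hy hmS'
      · exact h
    · -- `l₁ = [x]`: `x` lies above `l₂`, so `x` is the largest letter of `S'`
      right
      have hxS' : x ∈ S' := (Finset.mem_sdiff.mp ((hmem₁ x).mp (List.mem_singleton_self x))).1
      have hS'ne : S'.Nonempty := ⟨x, hxS'⟩
      have hx : S'.max' hS'ne = x := by
        refine le_antisymm ?_ (Finset.le_max' _ _ hxS')
        have hM := Finset.max'_mem S' hS'ne
        have : S'.max' hS'ne ∈ [x] ++ m :: l₂ := (hmem _).mpr ((hmemS _).mpr (Or.inr hM))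
        rcases List.mem_append.mp this with h | h
        · rw [List.mem_singleton] at h
          exact h.le
        · rcases List.mem_cons.mp h with h | h
          · exact absurd (h ▸ hM) hmS'
          · exact (hbelow x (List.mem_singleton_self x) _ h).le
      refine ⟨hS'ne, l₂, ?_, by rw [hx]; rfl⟩
      rw [hmem_av]
      refine ⟨⟨hn₂, fun y => ?_⟩, fun ⟨a, b, c, hs, hh⟩ => h123 ⟨a, b, c, hs.trans hsub, hh⟩,
        fun ⟨a, b, c, hs, hh⟩ => h132 ⟨a, b, c, hs.trans hsub, hh⟩,
        fun ⟨a, b, c, hs, hh⟩ => h213 ⟨a, b, c, hs.trans hsub, hh⟩⟩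
      rw [Finset.mem_erase, hx]
      constructor
      · intro hy
        exact ⟨(hbelow x (List.mem_singleton_self x) y hy).ne, hS'₂ y hy⟩
      · rintro ⟨hyx, hy⟩
        have := (hmem y).mpr ((hmemS y).mpr (Or.inr hy))
        rcases List.mem_append.mp this with h | h
        · exact absurd (List.mem_singleton.mp h) hyx
        · rcases List.mem_cons.mp h with rfl | h
          · exact absurd hy hmS'
          · exact h
    · -- `l₁ = x :: y :: t`: `x y m` is a `123` or a `213`
      exfalso
      have hs : [x, y].Sublist (x :: y :: t) :=
        List.cons_sublist_cons.mpr (List.cons_sublist_cons.mpr (List.nil_sublist t))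
      have hne : x ≠ y := fun h => by
        have := hn₁
        rw [h, List.nodup_cons] at this
        exact this.1 List.mem_cons_self
      rcases lt_or_gt_of_ne hne with h | h
      · exact h123 ((has123_append_max_iff _ _ m hm₁ hm₂).mpr (Or.inr (Or.inl ⟨x, y, hs, h⟩)))
      · exact h213 ((has213_append_max_iff _ _ m hm₁ hm₂).mpr (Or.inr (Or.inl ⟨x, y, hs, h⟩)))
  -- the count `A_{n+1} = A_n + A_{n−1}`
  rcases n with _ | n
  · -- `S = {m}`: the only avoider is `[m]`
    have hS'e : S' = ∅ := Finset.card_eq_zero.mp hS'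
    have hU : av S = (av S').image (fun l => m :: l) := by
      ext l
      simp only [Finset.mem_image]
      constructor
      · intro hl
        rcases hsplit l hl with ⟨l', hl', e⟩ | ⟨hne, -⟩
        · exact ⟨l', hl', e⟩
        · exact absurd hne (by rw [hS'e]; exact Finset.not_nonempty_empty)
      · rintro ⟨l', hl', rfl⟩
        exact hcons l' hl'
    rw [hU, Finset.card_image_of_injective _ List.cons_injective, hS'e, hav_empty, Finset.card_singleton]
    rfl
  · have hS'ne : S'.Nonempty := Finset.card_pos.mp (by rw [hS']; exact Nat.succ_pos n)
    have hx₀S' : S'.max' hS'ne ∈ S' := Finset.max'_mem _ _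
    have hU : av S = (av S').image (fun l => m :: l) ∪
        (av (S'.erase (S'.max' hS'ne))).image (fun l => S'.max' hS'ne :: m :: l) := by
      ext l
      simp only [Finset.mem_union, Finset.mem_image]
      constructor
      · intro hl
        rcases hsplit l hl with ⟨l', hl', e⟩ | ⟨hne, l'', hl'', e⟩
        · exact Or.inl ⟨l', hl', e⟩
        · exact Or.inr ⟨l'', hl'', e⟩
      · rintro (⟨l', hl', rfl⟩ | ⟨l'', hl'', rfl⟩)
        · exact hcons l' hl'
        · exact hcons₂ hS'ne l'' hl''
    have h3 : n + 1 + 1 + 1 = (n + 1) + 2 := rfl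
    rw [hU, Finset.card_union_of_disjoint, Finset.card_image_of_injective _ List.cons_injective,
      Finset.card_image_of_injective _ (fun l l' h => List.cons_injective (List.cons_injective h)),
      ih (n + 1) (by omega) S' hS', ih n (by omega) (S'.erase (S'.max' hS'ne))
        (by rw [Finset.card_erase_of_mem hx₀S', hS']; rfl), h3, Nat.fib_add_two (n := n + 1), add_comm]
    rw [Finset.disjoint_left]
    rintro l hl hl'
    rw [Finset.mem_image] at hl hl'
    obtain ⟨l', -, rfl⟩ := hl
    obtain ⟨l'', -, he⟩ := hl'
    simp only [List.cons.injEq] at he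
    exact hmS' (he.1 ▸ hx₀S')

/-- ★★★ **PROPOSITION 15 (Simion–Schmidt 1985)** «For every `n ≥ 1`, `A_n(123, 132, 213) = F_{n+1}`, where
`{F_n}_{n ≥ 0}` is the Fibonacci sequence, initialized by `F_0 = 0`, `F_1 = 1`» (Mathlib's `Nat.fib`; stated for every
`n`). [cite: SimionSchmidt1985, Proposition 15 (held text p0014)] -/
theorem card_av123_av132_av213 (n : ℕ) :
    Nat.card {v : Perm (Fin n) // ¬ PermContainsPattern v ![1, 2, 3] ∧ ¬ PermContainsPattern v ![1, 3, 2] ∧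
      ¬ PermContainsPattern v ![2, 1, 3]} = Nat.fib (n + 1) := by
  classical
  refine (natCard_perm_eq_card_filter_arrangements n
    (fun v : Perm (Fin n) => ¬ PermContainsPattern v ![1, 2, 3] ∧ ¬ PermContainsPattern v ![1, 3, 2] ∧
      ¬ PermContainsPattern v ![2, 1, 3])
    (fun l : List ℕ => (¬ ∃ a b c : ℕ, [a, b, c].Sublist l ∧ a < b ∧ b < c) ∧
      (¬ ∃ a b c : ℕ, [a, b, c].Sublist l ∧ a < c ∧ c < b) ∧ ¬ ∃ a b c : ℕ, [a, b, c].Sublist l ∧ b < a ∧ a < c)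
    (fun v => by rw [has123_ofFn_perm_iff, has132_ofFn_perm_iff, has213_ofFn_perm_iff])).trans ?_
  rw [card_arrangements_not123_not132_not213 (α := ℕ) (Finset.range n), Finset.card_range]

/-- PROPOSITION 15, the printed recurrence «`A_n(123,132,213) = A_{n−1}(123,132,213) + A_{n−2}(123,132,213)`».
[cite: SimionSchmidt1985, Proposition 15 (proof, held text p0014)] -/
theorem card_av123_av132_av213_add_two (n : ℕ) :
    Nat.card {v : Perm (Fin (n + 2)) // ¬ PermContainsPattern v ![1, 2, 3] ∧ ¬ PermContainsPattern v ![1, 3, 2] ∧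
      ¬ PermContainsPattern v ![2, 1, 3]} =
    Nat.card {v : Perm (Fin (n + 1)) // ¬ PermContainsPattern v ![1, 2, 3] ∧ ¬ PermContainsPattern v ![1, 3, 2] ∧
      ¬ PermContainsPattern v ![2, 1, 3]} +
    Nat.card {v : Perm (Fin n) // ¬ PermContainsPattern v ![1, 2, 3] ∧ ¬ PermContainsPattern v ![1, 3, 2] ∧
      ¬ PermContainsPattern v ![2, 1, 3]} := by
  rw [card_av123_av132_av213, card_av123_av132_av213, card_av123_av132_av213, Nat.fib_add_two, add_comm]

/-- PROPOSITION 15 with LEMMA 6 (a): `A_n(231, 312, 321) = F_{n+1}`. [cite: SimionSchmidt1985, Proposition 15 and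
Lemma 6 (a) (held text p0013–p0014)] -/
theorem card_av231_av312_av321 (n : ℕ) :
    Nat.card {v : Perm (Fin n) // ¬ PermContainsPattern v ![2, 3, 1] ∧ ¬ PermContainsPattern v ![3, 1, 2] ∧
      ¬ PermContainsPattern v ![3, 2, 1]} = Nat.fib (n + 1) := by
  rw [← card_av123_av132_av213_eq_card_av231_av312_av321, card_av123_av132_av213]

/-- Sanity values `A_3 = 3`, `A_4 = 5`, `A_5 = 8`. [cite: SimionSchmidt1985, Proposition 15 (held text p0014)] -/
theorem card_av123_av132_av213_small :
    Nat.card {v : Perm (Fin 3) // ¬ PermContainsPattern v ![1, 2, 3] ∧ ¬ PermContainsPattern v ![1, 3, 2] ∧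
      ¬ PermContainsPattern v ![2, 1, 3]} = 3 ∧
    Nat.card {v : Perm (Fin 4) // ¬ PermContainsPattern v ![1, 2, 3] ∧ ¬ PermContainsPattern v ![1, 3, 2] ∧
      ¬ PermContainsPattern v ![2, 1, 3]} = 5 ∧
    Nat.card {v : Perm (Fin 5) // ¬ PermContainsPattern v ![1, 2, 3] ∧ ¬ PermContainsPattern v ![1, 3, 2] ∧
      ¬ PermContainsPattern v ![2, 1, 3]} = 8 :=
  ⟨by rw [card_av123_av132_av213]; rfl, by rw [card_av123_av132_av213]; rfl, by rw [card_av123_av132_av213]; rfl⟩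

end Prop15

/-! ### §2 PROPOSITION 16 — `A_n(123, 132, 231) = n` -/

section Prop16

variable {α : Type*} [LinearOrder α]

/-- A decreasing word has no `231`-sublist. [cite: SimionSchmidt1985, Proposition 16 (proof, held text p0014–p0015)] -/
theorem not_has231_of_pairwise_gt {l : List α} (h : l.Pairwise (fun a b => b < a)) :
    ¬ ∃ a b c : α, [a, b, c].Sublist l ∧ c < a ∧ a < b := by
  rintro ⟨a, b, c, hs, -, hab⟩
  exact absurd (List.pairwise_iff_forall_sublist.mp h ((List.cons_sublist_cons.mpr
    (List.cons_sublist_cons.mpr (List.nil_sublist [c]))).trans hs)) (not_lt.mpr hab.le)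

/-- ★★ **Proposition 16 on words.** The arrangements of a finite set `S` of letters with no `123`-, `132`-, `231`-sublist
number `max(#S, 1)`: split an avoider at its largest letter `m`; `m` is first or last (no `132`, `231`); if last, the rest
decreases (no `123`) — one word; if first, the rest is any avoider on the other letters: `A_n = 1 + A_{n−1}`.
[cite: SimionSchmidt1985, Proposition 16 (held text p0014–p0015)] -/
theorem card_arrangements_not123_not132_not231
    [DecidablePred fun l : List α => (¬ ∃ a b c : α, [a, b, c].Sublist l ∧ a < b ∧ b < c) ∧
      (¬ ∃ a b c : α, [a, b, c].Sublist l ∧ a < c ∧ c < b) ∧ ¬ ∃ a b c : α, [a, b, c].Sublist l ∧ c < a ∧ a < b]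
    (S : Finset α) :
    ((Multiset.lists S.val).toFinset.filter (fun l => (¬ ∃ a b c : α, [a, b, c].Sublist l ∧ a < b ∧ b < c) ∧
      (¬ ∃ a b c : α, [a, b, c].Sublist l ∧ a < c ∧ c < b) ∧
        ¬ ∃ a b c : α, [a, b, c].Sublist l ∧ c < a ∧ a < b)).card = max S.card 1 := by
  set av : Finset α → Finset (List α) := fun T => (Multiset.lists T.val).toFinset.filter
    (fun l => (¬ ∃ a b c : α, [a, b, c].Sublist l ∧ a < b ∧ b < c) ∧
      (¬ ∃ a b c : α, [a, b, c].Sublist l ∧ a < c ∧ c < b) ∧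
        ¬ ∃ a b c : α, [a, b, c].Sublist l ∧ c < a ∧ a < b) with hav
  have hmem_av : ∀ (T : Finset α) (l : List α), l ∈ av T ↔ (l.Nodup ∧ ∀ x, x ∈ l ↔ x ∈ T) ∧
      (¬ ∃ a b c : α, [a, b, c].Sublist l ∧ a < b ∧ b < c) ∧ (¬ ∃ a b c : α, [a, b, c].Sublist l ∧ a < c ∧ c < b) ∧
        ¬ ∃ a b c : α, [a, b, c].Sublist l ∧ c < a ∧ a < b :=
    fun T l => by simp only [hav, Finset.mem_filter, mem_lists_toFinset_iff]
  have hav_empty : av ∅ = {[]} := by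
    simp only [hav, lists_toFinset_empty]
    rw [Finset.filter_singleton, if_pos ⟨by rintro ⟨a, b, c, h, -⟩; simp at h, by rintro ⟨a, b, c, h, -⟩; simp at h,
      by rintro ⟨a, b, c, h, -⟩; simp at h⟩]
  change (av S).card = max S.card 1
  obtain ⟨n, hn⟩ : ∃ n, S.card = n := ⟨_, rfl⟩
  induction n generalizing S with
  | zero => rw [hn, Finset.card_eq_zero.mp hn, hav_empty, Finset.card_singleton]; rfl
  | succ n ih =>
    rw [hn]
    have hS : S.Nonempty := Finset.card_pos.mp (by omega)
    set m := S.max' hS with hm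
    set S' := S.erase m with hS'def
    have hmS : m ∈ S := Finset.max'_mem S hS
    have hS' : S'.card = n := by rw [hS'def, Finset.card_erase_of_mem hmS, hn]; rfl
    have hltm : ∀ x ∈ S', x < m := fun x hx => Finset.lt_max'_of_mem_erase_max' S hS hx
    have hmS' : m ∉ S' := fun h => lt_irrefl m (hltm m h)
    have hmemS : ∀ x, x ∈ S ↔ x = m ∨ x ∈ S' := fun x => by
      rw [hS'def, Finset.mem_erase]
      constructor
      · intro hx
        by_cases h : x = m
        · exact Or.inl h
        · exact Or.inr ⟨h, hx⟩
      · rintro (rfl | ⟨-, hx⟩)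
        · exact hmS
        · exact hx
    -- `m` first: `m :: l'`
    have hcons : ∀ l' ∈ av S', m :: l' ∈ av S := fun l' hl' => by
      rw [hmem_av] at hl' ⊢
      obtain ⟨⟨hnd, hmem⟩, h123, h132, h231⟩ := hl'
      have hlt : ∀ y ∈ l', y < m := fun y hy => hltm y ((hmem y).mp hy)
      have e123 := has123_append_max_iff [] l' m (by simp) hlt
      have e132 := has132_append_max_iff [] l' m (by simp) hlt
      have e231 := has231_append_max_iff [] l' m (by simp) hlt
      rw [List.nil_append] at e123 e132 e231
      refine ⟨⟨List.nodup_cons.mpr ⟨fun h => hmS' ((hmem m).mp h), hnd⟩, fun x => ?_⟩, ?_, ?_, ?_⟩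
      · rw [List.mem_cons, hmemS, hmem]
      · rw [e123]
        rintro (h | ⟨a, b, h, -⟩ | ⟨x, hx, -⟩)
        · exact h123 h
        · simp at h
        · simp at hx
      · rw [e132]
        rintro (⟨a, b, c, h, -⟩ | h | ⟨x, hx, -⟩)
        · simp at h
        · exact h132 h
        · simp at hx
      · rw [e231]
        rintro (⟨a, b, c, h, -⟩ | h | ⟨x, hx, -⟩)
        · simp at h
        · exact h231 h
        · simp at hx
    -- `m` last: the decreasing word `(n − 1, …, 1, n)`
    set d : List α := ((S'.sort : List α)).reverse ++ [m] with hd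
    have hd_mem : d ∈ av S := by
      rw [hmem_av]
      have hgt := pairwise_gt_reverse_sort S'
      have hmemr : ∀ x, x ∈ ((S'.sort : List α)).reverse ↔ x ∈ S' := fun x => by
        rw [List.mem_reverse, Finset.mem_sort]
      have hlt : ∀ x ∈ ((S'.sort : List α)).reverse, x < m := fun x hx => hltm x ((hmemr x).mp hx)
      have e123 := has123_append_max_iff _ [] m hlt (by simp)
      have e132 := has132_append_max_iff _ [] m hlt (by simp)
      have e231 := has231_append_max_iff _ [] m hlt (by simp)
      refine ⟨⟨?_, fun x => ?_⟩, ?_, ?_, ?_⟩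
      · rw [hd, List.nodup_append]
        refine ⟨List.nodup_reverse.mpr (Finset.sort_nodup _ _), List.nodup_singleton m, fun x hx y hy => ?_⟩
        rw [List.mem_singleton] at hy
        rw [hy]
        exact (hlt x hx).ne
      · rw [hd, List.mem_append, List.mem_singleton, hmemr, hmemS, or_comm]
      · rw [hd, e123]
        rintro (⟨a, b, c, h, -⟩ | h | ⟨x, -, b, c, h, -⟩)
        · simp at h
        · exact not_has12_of_pairwise_gt hgt h
        · simp at h
      · rw [hd, e132]
        rintro (h | ⟨a, b, c, h, -⟩ | ⟨x, -, y, hy, -⟩)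
        · exact not_has132_of_pairwise_gt hgt h
        · simp at h
        · simp at hy
      · rw [hd, e231]
        rintro (h | ⟨a, b, c, h, -⟩ | ⟨x, -, y, hy, -⟩)
        · exact not_has231_of_pairwise_gt hgt h
        · simp at h
        · simp at hy
    -- every avoider is `m :: l'` or `d`
    have hsplit : ∀ l ∈ av S, (∃ l' ∈ av S', m :: l' = l) ∨ l = d := fun l hl => by
      rw [hmem_av] at hl
      obtain ⟨⟨hnd, hmem⟩, h123, h132, h231⟩ := hl
      obtain ⟨l₁, l₂, rfl, hn₁, hn₂, -, hmem₂, hmem₁, hm₁, hm₂, hbelow⟩ :=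
        exists_split_at_max S' hltm hnd (fun x => by rw [hmem x, hmemS]) h132
      have hS'₂ : ∀ y ∈ l₂, y ∈ S' := fun y hy => Finset.filter_subset _ _ ((hmem₂ y).mp hy)
      have hS'₁ : ∀ x ∈ l₁, x ∈ S' := fun x hx => Finset.sdiff_subset ((hmem₁ x).mp hx)
      by_cases h₁ : l₁ = []
      · subst h₁
        left
        have hsub : l₂.Sublist ([] ++ m :: l₂) := List.sublist_cons_self m l₂
        refine ⟨l₂, ?_, rfl⟩
        rw [hmem_av]
        refine ⟨⟨hn₂, fun y => ⟨hS'₂ y, fun hy => ?_⟩⟩, fun ⟨a, b, c, hs, hh⟩ => h123 ⟨a, b, c, hs.trans hsub, hh⟩,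
          fun ⟨a, b, c, hs, hh⟩ => h132 ⟨a, b, c, hs.trans hsub, hh⟩,
          fun ⟨a, b, c, hs, hh⟩ => h231 ⟨a, b, c, hs.trans hsub, hh⟩⟩
        have := (hmem y).mpr ((hmemS y).mpr (Or.inr hy))
        rw [List.nil_append, List.mem_cons] at this
        rcases this with rfl | h
        · exact absurd hy hmS'
        · exact h
      by_cases h₂ : l₂ = []
      · subst h₂
        right
        -- `l₁` decreases (no `123` ending in `m`) and uses all of `S'`
        have hgt : l₁.Pairwise (fun a b => b < a) := pairwise_gt_of_not_has12 hn₁ fun ⟨a, b, hs, hab⟩ =>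
          h123 ((has123_append_max_iff l₁ [] m hm₁ hm₂).mpr (Or.inr (Or.inl ⟨a, b, hs, hab⟩)))
        have hmem₁' : ∀ x, x ∈ l₁ ↔ x ∈ S' := fun x => ⟨hS'₁ x, fun hx => by
          have := (hmem x).mpr ((hmemS x).mpr (Or.inr hx))
          rw [List.mem_append, List.mem_singleton] at this
          rcases this with h | rfl
          · exact h
          · exact absurd hx hmS'⟩
        rw [hd, eq_reverse_sort_of_pairwise_gt hgt hmem₁']
      -- both sides nonempty: a `132` or a `231` through `m`
      exfalso
      obtain ⟨x, hx⟩ := List.exists_mem_of_ne_nil l₁ h₁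
      obtain ⟨y, hy⟩ := List.exists_mem_of_ne_nil l₂ h₂
      exact h231 ((has231_append_max_iff l₁ l₂ m hm₁ hm₂).mpr (Or.inr (Or.inr ⟨x, hx, y, hy, hbelow x hx y hy⟩)))
    have hU : av S = (av S').image (fun l => m :: l) ∪ {d} := by
      ext l
      simp only [Finset.mem_union, Finset.mem_image, Finset.mem_singleton]
      constructor
      · exact hsplit l
      · rintro (⟨l', hl', rfl⟩ | rfl)
        · exact hcons l' hl'
        · exact hd_mem
    rw [hU]
    rcases n with _ | n
    · -- `S = {m}`: both words are `[m]`
      have hS'e : S' = ∅ := Finset.card_eq_zero.mp hS'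
      have hde : d = [m] := by rw [hd, hS'e]; simp
      rw [hS'e, hav_empty, hde]
      simp
    · rw [Finset.card_union_of_disjoint, Finset.card_image_of_injective _ List.cons_injective, ih S' hS',
        Finset.card_singleton, hS']
      · omega
      · rw [Finset.disjoint_singleton_right, Finset.mem_image]
        rintro ⟨l', -, he⟩
        -- `m :: l' = d` puts `m` first in `d`, but `d` starts with the largest letter of `S' ≠ ∅`
        have hS'ne : S'.Nonempty := Finset.card_pos.mp (by rw [hS']; exact Nat.succ_pos n)
        have hne : ((S'.sort : List α)).reverse ≠ [] := by
          rw [ne_eq, List.reverse_eq_nil_iff, ← List.length_eq_zero_iff, Finset.length_sort, hS']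
          exact Nat.succ_ne_zero n
        obtain ⟨z, t, hz⟩ := List.exists_cons_of_ne_nil hne
        rw [hd, hz, List.cons_append, List.cons.injEq] at he
        have hzS' : z ∈ S' := by
          rw [← Finset.mem_sort (· ≤ ·), ← List.mem_reverse, hz]
          exact List.mem_cons_self
        exact hmS' (he.1 ▸ hzS')

/-- ★★★ **PROPOSITION 16 (Simion–Schmidt 1985)** «For all `n ≥ 1`, `A_n(123, 132, 231) = n`».
[cite: SimionSchmidt1985, Proposition 16 (held text p0014–p0015)] -/
theorem card_av123_av132_av231 (n : ℕ) (hn : 1 ≤ n) :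
    Nat.card {v : Perm (Fin n) // ¬ PermContainsPattern v ![1, 2, 3] ∧ ¬ PermContainsPattern v ![1, 3, 2] ∧
      ¬ PermContainsPattern v ![2, 3, 1]} = n := by
  classical
  refine (natCard_perm_eq_card_filter_arrangements n
    (fun v : Perm (Fin n) => ¬ PermContainsPattern v ![1, 2, 3] ∧ ¬ PermContainsPattern v ![1, 3, 2] ∧
      ¬ PermContainsPattern v ![2, 3, 1])
    (fun l : List ℕ => (¬ ∃ a b c : ℕ, [a, b, c].Sublist l ∧ a < b ∧ b < c) ∧
      (¬ ∃ a b c : ℕ, [a, b, c].Sublist l ∧ a < c ∧ c < b) ∧ ¬ ∃ a b c : ℕ, [a, b, c].Sublist l ∧ c < a ∧ a < b)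
    (fun v => by rw [has123_ofFn_perm_iff, has132_ofFn_perm_iff, has231_ofFn_perm_iff])).trans ?_
  rw [card_arrangements_not123_not132_not231 (α := ℕ) (Finset.range n), Finset.card_range]
  exact max_eq_left hn

/-- PROPOSITION 16 for every `n`: `A_n(123, 132, 231) = max(n, 1)` (`A_0 = 1`).
[cite: SimionSchmidt1985, Proposition 16 (held text p0014–p0015)] -/
theorem card_av123_av132_av231_eq_max (n : ℕ) :
    Nat.card {v : Perm (Fin n) // ¬ PermContainsPattern v ![1, 2, 3] ∧ ¬ PermContainsPattern v ![1, 3, 2] ∧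
      ¬ PermContainsPattern v ![2, 3, 1]} = max n 1 := by
  classical
  refine (natCard_perm_eq_card_filter_arrangements n
    (fun v : Perm (Fin n) => ¬ PermContainsPattern v ![1, 2, 3] ∧ ¬ PermContainsPattern v ![1, 3, 2] ∧
      ¬ PermContainsPattern v ![2, 3, 1])
    (fun l : List ℕ => (¬ ∃ a b c : ℕ, [a, b, c].Sublist l ∧ a < b ∧ b < c) ∧
      (¬ ∃ a b c : ℕ, [a, b, c].Sublist l ∧ a < c ∧ c < b) ∧ ¬ ∃ a b c : ℕ, [a, b, c].Sublist l ∧ c < a ∧ a < b)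
    (fun v => by rw [has123_ofFn_perm_iff, has132_ofFn_perm_iff, has231_ofFn_perm_iff])).trans ?_
  rw [card_arrangements_not123_not132_not231 (α := ℕ) (Finset.range n), Finset.card_range]

/-- PROPOSITION 16, the printed recurrence «`A_n(123, 132, 231) = 1 + A_{n−1}(123, 132, 231)`» (`n ≥ 2`).
[cite: SimionSchmidt1985, Proposition 16 (proof, held text p0015)] -/
theorem card_av123_av132_av231_succ (n : ℕ) (hn : 1 ≤ n) :
    Nat.card {v : Perm (Fin (n + 1)) // ¬ PermContainsPattern v ![1, 2, 3] ∧ ¬ PermContainsPattern v ![1, 3, 2] ∧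
      ¬ PermContainsPattern v ![2, 3, 1]} =
    1 + Nat.card {v : Perm (Fin n) // ¬ PermContainsPattern v ![1, 2, 3] ∧ ¬ PermContainsPattern v ![1, 3, 2] ∧
      ¬ PermContainsPattern v ![2, 3, 1]} := by
  rw [card_av123_av132_av231 n hn, card_av123_av132_av231 (n + 1) (Nat.succ_pos n), add_comm]

/-- PROPOSITION 16 with LEMMA 6 (b): `A_n(123, 213, 312) = n`. [cite: SimionSchmidt1985, Proposition 16 and Lemma 6
(b) (held text p0013–p0015)] -/
theorem card_av123_av213_av312 (n : ℕ) (hn : 1 ≤ n) :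
    Nat.card {v : Perm (Fin n) // ¬ PermContainsPattern v ![1, 2, 3] ∧ ¬ PermContainsPattern v ![2, 1, 3] ∧
      ¬ PermContainsPattern v ![3, 1, 2]} = n := by
  rw [← card_av123_av132_av231_eq_card_av123_av213_av312, card_av123_av132_av231 n hn]

/-- PROPOSITION 16 with LEMMA 6 (b): `A_n(132, 231, 321) = n`. [cite: SimionSchmidt1985, Proposition 16 and Lemma 6
(b) (held text p0013–p0015)] -/
theorem card_av132_av231_av321 (n : ℕ) (hn : 1 ≤ n) :
    Nat.card {v : Perm (Fin n) // ¬ PermContainsPattern v ![1, 3, 2] ∧ ¬ PermContainsPattern v ![2, 3, 1] ∧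
      ¬ PermContainsPattern v ![3, 2, 1]} = n := by
  rw [← card_av123_av132_av231_eq_card_av132_av231_av321, card_av123_av132_av231 n hn]

/-- PROPOSITION 16 with LEMMA 6 (b): `A_n(213, 312, 321) = n`. [cite: SimionSchmidt1985, Proposition 16 and Lemma 6
(b) (held text p0013–p0015)] -/
theorem card_av213_av312_av321 (n : ℕ) (hn : 1 ≤ n) :
    Nat.card {v : Perm (Fin n) // ¬ PermContainsPattern v ![2, 1, 3] ∧ ¬ PermContainsPattern v ![3, 1, 2] ∧
      ¬ PermContainsPattern v ![3, 2, 1]} = n := by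
  rw [← card_av123_av132_av231_eq_card_av213_av312_av321, card_av123_av132_av231 n hn]

end Prop16

end PermContainsPattern

end Literature.Combinatorics.Enumerative
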